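import Mathlib

/-!
# The complex SONIC TRIANGLE `𝒟_ρ` around the sonic window: geometry and the Cauchy estimate between nested triangles
# (crux `DenseExcursion`, stmt-AtomisticToContinuum-12586, line `sonic-cavity-renewal` v9, stub `stub_analyticPackingImplosion`)

Helper file (`--supports stmt-AtomisticToContinuum-12586`, line lead a2, wave-5 worker D2, task
`sonicWindow_analytic_bound`, worker reports `work/stubs/D1_gammaClosure.REPORT.md` §3.2 and `D2_triangle.REPORT.md`).
The window estimate of the order-`k` packing problem is carried out in SUP norms on the open triangle
`𝒟_ρ := {z : ℂ | −3ρ < Re z < ρ, |Im z| < (Re z + 3ρ)/2}` (vertices `−3ρ`, `ρ ± 2ρ i`; pinched at the real inflow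
point `−3ρ` of the regular characteristic, slopes `±1/2`). Kernel-checked here, once and for all:

* the elementary geometry: `𝒟_ρ` is open and convex, contains the real window `(−3ρ, ρ)` and `0`, lies in the disc
  `‖z‖ < 3ρ`, is monotone in `ρ`, and every `z ∈ 𝒟_ρ` is the endpoint of the slanted segment from the REAL point
  `p(z) = Re z − 2|Im z| ∈ (−3ρ, ρ)` inside `𝒟_ρ` (the transport ray of the window estimate);
* the nesting `closedBall z (ρ′ − ρ) ⊆ 𝒟_{ρ′}` for `z ∈ 𝒟_ρ`, `ρ < ρ′` (the homothety constant is exactly `1` for the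
  slope `1/2`, since `3·(1/2)/√(1 + 1/4) = 3/√5 > 1`);
* `triangle_cauchy_deriv` (REGISTERED helper): for `F` holomorphic on `𝒟_{ρ′}` with `‖F‖ ≤ K` there,
  `‖F′ z‖ ≤ K/(ρ′ − ρ)` on `𝒟_ρ` — the Cauchy estimate that pays one `x`-derivative of the order-`j` coefficient in the
  Cauchy–Kovalevskaya nesting of the window induction (`Complex.norm_deriv_le_of_forall_mem_sphere_norm_le`).

Sources: standard (Cauchy's inequality; Nirenberg–Nishida nested domains, cf. L. Nirenberg, J. Diff. Geom. 6 (1972)).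
NOT here: the profile, the transport/Euler estimates, or `Γ`.
-/

noncomputable section

open Set Metric Complex

namespace Summit.AtomisticToContinuum.HydrodynamicLimit.Theorems.PackingAnalyticImplosion

/-! ## Geometry of the triangle -/

/-- The sonic triangle is open. [folklore] -/
theorem isOpen_sonicTriangle (ρ : ℝ) :
    IsOpen {z : ℂ | -(3 * ρ) < z.re ∧ z.re < ρ ∧ |z.im| < (z.re + 3 * ρ) / 2} := by
  have h1 : IsOpen {z : ℂ | -(3 * ρ) < z.re} := isOpen_lt continuous_const Complex.continuous_re
  have h2 : IsOpen {z : ℂ | z.re < ρ} := isOpen_lt Complex.continuous_re continuous_const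
  have h3 : IsOpen {z : ℂ | |z.im| < (z.re + 3 * ρ) / 2} :=
    isOpen_lt (continuous_abs.comp Complex.continuous_im) (by fun_prop)
  simpa only [setOf_and] using h1.inter (h2.inter h3)

/-- The sonic triangle is convex. [folklore] -/
theorem convex_sonicTriangle (ρ : ℝ) :
    Convex ℝ {z : ℂ | -(3 * ρ) < z.re ∧ z.re < ρ ∧ |z.im| < (z.re + 3 * ρ) / 2} := by
  intro z hz w hw a b ha hb hab
  obtain ⟨hz1, hz2, hz3⟩ := hz
  obtain ⟨hw1, hw2, hw3⟩ := hw
  have hre : (a • z + b • w).re = a * z.re + b * w.re := by simp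
  have him : (a • z + b • w).im = a * z.im + b * w.im := by simp
  rw [abs_lt] at hz3 hw3
  have key : ∀ {c x y : ℝ}, x < c → y < c → a * x + b * y < c := fun {c x y} hx hy => by
    have h := (convex_Iio c) hx hy ha hb hab
    simpa [smul_eq_mul] using h
  have k1 := key (c := 3 * ρ) (x := -z.re) (y := -w.re) (by linarith) (by linarith)
  have k2 := key (c := ρ) (x := z.re) (y := w.re) hz2 hw2
  have k3 := key (c := 3 * ρ / 2) (x := z.im - z.re / 2) (y := w.im - w.re / 2) (by linarith) (by linarith)
  have k4 := key (c := 3 * ρ / 2) (x := -z.im - z.re / 2) (y := -w.im - w.re / 2) (by linarith) (by linarith)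
  simp only [mem_setOf_eq, hre, him]
  refine ⟨by linarith, by linarith, ?_⟩
  rw [abs_lt]
  constructor <;> linarith

/-- Real points of the window lie in the triangle. [folklore] -/
theorem ofReal_mem_sonicTriangle {ρ x : ℝ} (h1 : -(3 * ρ) < x) (h2 : x < ρ) :
    (x : ℂ) ∈ {z : ℂ | -(3 * ρ) < z.re ∧ z.re < ρ ∧ |z.im| < (z.re + 3 * ρ) / 2} := by
  refine ⟨by simpa using h1, by simpa using h2, ?_⟩
  simp only [Complex.ofReal_im, abs_zero, Complex.ofReal_re]
  linarith

/-- `0` lies in the triangle. [folklore] -/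
theorem zero_mem_sonicTriangle {ρ : ℝ} (hρ : 0 < ρ) :
    (0 : ℂ) ∈ {z : ℂ | -(3 * ρ) < z.re ∧ z.re < ρ ∧ |z.im| < (z.re + 3 * ρ) / 2} := by
  simpa using ofReal_mem_sonicTriangle (x := 0) (ρ := ρ) (by linarith) hρ

/-- The triangle is star-convex with respect to each of its points (it is convex). [folklore] -/
theorem starConvex_sonicTriangle {ρ : ℝ} {z₀ : ℂ}
    (h : z₀ ∈ {z : ℂ | -(3 * ρ) < z.re ∧ z.re < ρ ∧ |z.im| < (z.re + 3 * ρ) / 2}) :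
    StarConvex ℝ z₀ {z : ℂ | -(3 * ρ) < z.re ∧ z.re < ρ ∧ |z.im| < (z.re + 3 * ρ) / 2} :=
  (convex_sonicTriangle ρ).starConvex h

/-- The triangle lies in the disc of radius `3ρ`. [folklore] -/
theorem norm_lt_of_mem_sonicTriangle {ρ : ℝ} {z : ℂ}
    (h : z ∈ {z : ℂ | -(3 * ρ) < z.re ∧ z.re < ρ ∧ |z.im| < (z.re + 3 * ρ) / 2}) : ‖z‖ < 3 * ρ := by
  obtain ⟨h1, h2, h3⟩ := h
  have hρ : 0 < ρ := by linarith
  rw [abs_lt] at h3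
  have hsq : z.re ^ 2 + z.im ^ 2 < (3 * ρ) ^ 2 := by nlinarith
  have hn : ‖z‖ = Real.sqrt (z.re ^ 2 + z.im ^ 2) := by
    rw [Complex.norm_eq_sqrt_sq_add_sq]
  rw [hn, Real.sqrt_lt' (by linarith)]
  exact hsq

/-- The triangles are nested: `𝒟_ρ ⊆ 𝒟_{ρ′}` for `ρ ≤ ρ′`. [folklore] -/
theorem sonicTriangle_mono {ρ ρ' : ℝ} (h : ρ ≤ ρ') :
    {z : ℂ | -(3 * ρ) < z.re ∧ z.re < ρ ∧ |z.im| < (z.re + 3 * ρ) / 2} ⊆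
      {z : ℂ | -(3 * ρ') < z.re ∧ z.re < ρ' ∧ |z.im| < (z.re + 3 * ρ') / 2} := by
  rintro z ⟨h1, h2, h3⟩
  exact ⟨by linarith, by linarith, by linarith⟩

/-- The foot of the slanted transport ray: for `z ∈ 𝒟_ρ` the real point `p(z) = Re z − 2|Im z|` lies in the window
`(−3ρ, ρ)` (and `p(z) ≤ Re z`). [folklore] -/
theorem rayFoot_mem_window {ρ : ℝ} {z : ℂ}
    (h : z ∈ {z : ℂ | -(3 * ρ) < z.re ∧ z.re < ρ ∧ |z.im| < (z.re + 3 * ρ) / 2}) :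
    -(3 * ρ) < z.re - 2 * |z.im| ∧ z.re - 2 * |z.im| < ρ ∧ z.re - 2 * |z.im| ≤ z.re := by
  obtain ⟨h1, h2, h3⟩ := h
  have h0 : 0 ≤ |z.im| := abs_nonneg _
  exact ⟨by linarith, by linarith, by linarith⟩

/-- The slanted ray from the foot `p(z)` to `z` lies in the triangle: `p + t (z − p) ∈ 𝒟_ρ` for `t ∈ [0, 1]`. [folklore] -/
theorem ray_mem_sonicTriangle {ρ : ℝ} {z : ℂ}
    (h : z ∈ {z : ℂ | -(3 * ρ) < z.re ∧ z.re < ρ ∧ |z.im| < (z.re + 3 * ρ) / 2}) {t : ℝ} (ht : t ∈ Icc (0 : ℝ) 1) :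
    (((z.re - 2 * |z.im| : ℝ) : ℂ) + (t : ℂ) * (z - ((z.re - 2 * |z.im| : ℝ) : ℂ))) ∈
      {z : ℂ | -(3 * ρ) < z.re ∧ z.re < ρ ∧ |z.im| < (z.re + 3 * ρ) / 2} := by
  obtain ⟨hp1, hp2, -⟩ := rayFoot_mem_window h
  have hp := ofReal_mem_sonicTriangle hp1 hp2
  have hseg := (starConvex_sonicTriangle hp) h (sub_nonneg.2 ht.2) ht.1 (sub_add_cancel 1 t)
  have e : (1 - t) • (((z.re - 2 * |z.im| : ℝ) : ℂ)) + t • z =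
      ((z.re - 2 * |z.im| : ℝ) : ℂ) + (t : ℂ) * (z - ((z.re - 2 * |z.im| : ℝ) : ℂ)) := by
    rw [Complex.real_smul, Complex.real_smul]; push_cast; ring
  rw [e] at hseg
  exact hseg

/-- The length of the slanted ray: `‖z − p(z)‖ = √5 |Im z|`, in the usable form `‖z − p(z)‖ ^ 2 = 5 (Im z)²` and
`2 |Im z| ≤ ‖z − p(z)‖`. [folklore] -/
theorem norm_sub_rayFoot {z : ℂ} :
    ‖z - ((z.re - 2 * |z.im| : ℝ) : ℂ)‖ ^ 2 = 5 * z.im ^ 2 ∧ 2 * |z.im| ≤ ‖z - ((z.re - 2 * |z.im| : ℝ) : ℂ)‖ := by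
  have hre : (z - ((z.re - 2 * |z.im| : ℝ) : ℂ)).re = 2 * |z.im| := by simp
  have him : (z - ((z.re - 2 * |z.im| : ℝ) : ℂ)).im = z.im := by simp
  have hsq : ‖z - ((z.re - 2 * |z.im| : ℝ) : ℂ)‖ ^ 2 = 5 * z.im ^ 2 := by
    rw [Complex.sq_norm, Complex.normSq_apply, hre, him]
    nlinarith [sq_abs z.im]
  refine ⟨hsq, ?_⟩
  have h0 : 0 ≤ ‖z - ((z.re - 2 * |z.im| : ℝ) : ℂ)‖ := norm_nonneg _
  have h1 : 0 ≤ |z.im| := abs_nonneg _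
  nlinarith [sq_abs z.im, sq_nonneg (‖z - ((z.re - 2 * |z.im| : ℝ) : ℂ)‖ - 2 * |z.im|)]

/-- NESTING FOR CAUCHY ESTIMATES: for `z ∈ 𝒟_ρ` and `ρ < ρ′` the closed disc of radius `ρ′ − ρ` about `z` lies in
`𝒟_{ρ′}` (homothety constant `1` for slope `1/2`). [folklore] -/
theorem closedBall_subset_sonicTriangle {ρ ρ' : ℝ} (hρ : ρ < ρ') {z : ℂ}
    (h : z ∈ {z : ℂ | -(3 * ρ) < z.re ∧ z.re < ρ ∧ |z.im| < (z.re + 3 * ρ) / 2}) :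
    closedBall z (ρ' - ρ) ⊆ {z : ℂ | -(3 * ρ') < z.re ∧ z.re < ρ' ∧ |z.im| < (z.re + 3 * ρ') / 2} := by
  intro w hw
  obtain ⟨h1, h2, h3⟩ := h
  rw [mem_closedBall, dist_eq_norm] at hw
  have hre : |(w - z).re| ≤ ρ' - ρ := (Complex.abs_re_le_norm _).trans hw
  have him : |(w - z).im| ≤ ρ' - ρ := (Complex.abs_im_le_norm _).trans hw
  rw [Complex.sub_re, abs_le] at hre
  rw [Complex.sub_im, abs_le] at him
  rw [abs_lt] at h3
  obtain ⟨h3a, h3b⟩ := h3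
  simp only [mem_setOf_eq]
  refine ⟨by linarith, by linarith, ?_⟩
  rw [abs_lt]
  constructor <;> linarith

/-! ## The Cauchy estimate between nested triangles -/

/-- **CAUCHY ESTIMATE BETWEEN NESTED SONIC TRIANGLES** (registered helper `triangle_cauchy_deriv` of
`stub_analyticPackingImplosion`): if `F` is holomorphic on `𝒟_{ρ′}` with `‖F‖ ≤ K` there, then `‖F′ z‖ ≤ K/(ρ′ − ρ)` for every
`z ∈ 𝒟_ρ`, `0 < ρ < ρ′`. [folklore] -/
theorem triangle_cauchy_deriv : ∀ (ρ ρ' : ℝ) (F : ℂ → ℂ) (K : ℝ), 0 < ρ → ρ < ρ' → DifferentiableOn ℂ F {z : ℂ | -(3 * ρ') < z.re ∧ z.re < ρ' ∧ |z.im| < (z.re + 3 * ρ') / 2} → (∀ w ∈ {z : ℂ | -(3 * ρ') < z.re ∧ z.re < ρ' ∧ |z.im| < (z.re + 3 * ρ') / 2}, ‖F w‖ ≤ K) → ∀ z ∈ {z : ℂ | -(3 * ρ) < z.re ∧ z.re < ρ ∧ |z.im| < (z.re + 3 * ρ) / 2}, ‖deriv F z‖ ≤ K / (ρ' - ρ)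 := by
  intro ρ ρ' F K hρ hρρ' hF hK z hz
  have hR : 0 < ρ' - ρ := sub_pos.2 hρρ'
  have hsub := closedBall_subset_sonicTriangle hρρ' hz
  have hd : DiffContOnCl ℂ F (ball z (ρ' - ρ)) := by
    refine DifferentiableOn.diffContOnCl ?_
    rw [closure_ball z hR.ne']
    exact hF.mono hsub
  exact Complex.norm_deriv_le_of_forall_mem_sphere_norm_le hR hd
    (fun w hw => hK w (hsub (sphere_subset_closedBall hw)))

end Summit.AtomisticToContinuum.HydrodynamicLimit.Theorems.PackingAnalyticImplosion

end
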